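import Summits.QuantumFields.BalabanUV.Beta.D1BFx.LatticeHLSDamped

/-!
# `BalabanUV.Beta.D1BFx.NeedleHLSGain` — road «BF-x» for binder row D1, slot (K), END row `hGrp gN`, «GN-33 ∕ NN» LETTERS, PART 1: the damped
# two-centre sum CUBIC × LINEAR with the POWER GAIN `1∕nrm(u−v)` in place of the critical `log` (`Σ_x e^{−ε‖x−u‖}∕(nrm(x−u)^{d−1}·nrm(x−v)) ≤
# c_d·(1+2∕ε)∕nrm(u−v)`), and the NEEDLE BOOKKEEPING through `applyK` ∕ `pairing` (needle-weighted pointwise profiles in, needle-weighted bounds out)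

HONEST DEPENDENCY (cell records, verbatim): «continuum YM on T⁴ ⇐ BetaPertH ∧ nine spine estimates (0/9 proved); BetaPertH ⇐ (D1) ∧ (D4) ∧
CAP+tail; G-an2-4 gates asym, D1 and NE2/3/4.»  HONEST FRAMING (cell contract, verbatim): «discharging `BetaPertH` makes Bałaban's UV stability
UNCONDITIONAL — a real constructive-QFT result; it is NOT the continuum limit and NOT the Clay problem.»  THIS MODULE DISCHARGES NOTHING of the
wall: [folklore] lattice bookkeeping over leaf-04-g9's HLS kit (`LatticeHLSRadial.sum_inv_nrm_pow_le` ∕ `sum_exp_div_nrm_pow_le`, `LatticeHLS.nrm_ge_of_near`,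
`LatticeHLSProfiles.summable_and_abs_tsum_le_of_abs_sum_le`) and the owner's `RankOneBubble.pairing` ∕ `applyK`; `A`, `ψ`, `χ`, `φ`, the needle index sets
`N`, weights `q` and profiles `g` are ARBITRARY.  No `def`, no `def … : Prop`, nothing cited, nothing of Bałaban's asserted, 0 sorry.  Root-level binders
hW ∕ hR-sockets ∕ hSX-socket ∕ D1Tel ∕ D1Rep — 0 discharged; (K) NOT closed; NOT D1, NOT `BetaPertH`, NOT continuum, NOT Clay.

ABSOLUTE RULE (cell charter, verbatim): «No internally-minted statement may enter as a cited fact. Every hypothesis is either kernel-proved in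
this package or a verbatim quotation of a PUBLISHED theorem with page reference. The manuscript(s) under audit are NOT citable for their own
disputed steps — they are the thing under adjudication; programme-internal (2001/route/tribunal) claims are never citable.»

WHY (owner claim table «GN-CELLS» = `HOME/b2b-balaban-beta-d1-p2/GLUON-NEEDLE-ROWS.md` v0.2, R3 cell `ndl ⊗ ndl`; an3-g57 `N36-SPLIT.v1.md` §3′ (3)
«`𝔅(ρ_u,ρ_{u′}) ≤ k n⁻⁴·(1 + log(n∕nrm(u−u′)))` (discrete `Σ_x nrm(x−u)^{−a}·nrm(x−u′)^{−b} ≤ c·nrm(u−u′)^{4−a−b}` for `a,b < 4 < a+b`, `c·(1+log)` at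
`a+b = 4` …)»; MINE journal 2026-08-21 l.30734).  In the `ndl ⊗ ndl` cell the pairing `𝔅(row_p, row_u) = ⟨∇row_p, Ga∇row_u⟩` of two needle potentials is,
per pair of needle sites `(s, s′)`, the critical two-centre sum `(3,1)`: the kit's `sum_exp_div_nrm_pow_mul_crit_le` bounds it by `c·log n` — NOT n-uniform.
§1 keeps the damping at the cubic centre and pays the logarithm with a POWER of the centre distance instead: `≤ c(1+2∕ε)∕nrm(s−s′)` (`log t ≤ t`); at
`ε = δ∕n` this is `k·n∕nrm(s−s′)`, one power of `n` worse than §3′'s `k·(1+log(n∕nrm))` near the diagonal but SUMMABLE BY THE CENSUS: the bond marginal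
`Σ_{p∈B(β)}|qJet_p s| ≤ (n−1)n⁻⁴` (`NeedleBondMarginal.sum_bond_abs_qJet_le`) and `Σ_{s∈B(β)} 1∕nrm(s−s′) ≤ c·n³` turn `n·Σ_{s,s′} q q′∕nrm(s−s′)` into
`c·W_u` per block — exactly what the cell's w-sum needs (log-FREE).  §2 is the finite-sum plumbing that carries needle sums `Σ_s q s·(…)` through the
owner's `applyK` and `pairing` (both `tsum`s), so that every letter of the cell is stated with the needle weights OUTSIDE the lattice sums.

CONTENT (`F` a finite fibre type).
* §1 [folklore] `exp_neg_half_mul_succ_le`; **`sum_exp_div_nrm_pow_mul_nrm_le`** (`d ≥ 2`):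
  `Σ_{x∈S} e^{−ε‖x−u‖}∕(nrm(x−u)^{d−1}·nrm(x−v)) ≤ (1+2d·3^{d−1})(2+3^{d−1})(1+2∕ε)∕nrm(u−v)`.
* §2 [folklore] **`abs_applyK_le_of_needle`**, **`abs_pairing_le_of_needle_left`**, **`abs_pairing_le_of_needle_needle`**.
NOT HERE (honest): the `d = 4` letters (`NeedleNdlNdlLetters`), the instantiation, the cell.
Unit `b2b-balaban-gan24-formalise-leaf-05` (gen 42), G-an2-4 swarm leaf prover on cross-lane kernel duty; `LEAVES-BFx.md` row (N) «GN-33∕NN».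
-/

namespace Summit.QuantumFields.BalabanUV.Beta.D1BFx.NeedleHLSGain

open Finset
open scoped BigOperators
open Literature.MathematicalPhysics.QuantumFieldTheory.Balaban1983to89.Beta
open ExpKernelCalculus (Site MKer)
open PoissonInterior (supNorm nrm nrm_pos nrm_neg supNorm_neg supNorm_add_le one_le_nrm supNorm_le_nrm)
open LatticeHLSRadial (nrm_eq_max sum_inv_nrm_pow_le sum_exp_div_nrm_pow_le)
open LatticeHLS (nrm_ge_of_near)
open LatticeHLSProfiles (summable_and_abs_tsum_le_of_abs_sum_le)
open RankOneBubble (pairing applyK pairing_def applyK_apply)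

variable {d : ℕ} {F : Type*} [Fintype F]

/-! ## §1 Two centres, cubic × linear, damped at the cubic centre: the power gain `1∕nrm(u−v)` -/

/-- [folklore] `e^{−εR∕2}·(R+1) ≤ 1 + 2∕ε` for `ε > 0`, `R ≥ 0` (from `1 + t ≤ e^t`). -/
theorem exp_neg_half_mul_succ_le {ε : ℝ} (hε : 0 < ε) {R : ℝ} (hR : 0 ≤ R) :
    Real.exp (-(ε * R / 2)) * (R + 1) ≤ 1 + 2 / ε := by
  have h1 : 1 + ε * R / 2 ≤ Real.exp (ε * R / 2) := by linarith [Real.add_one_le_exp (ε * R / 2)]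
  have h2 : 0 < 1 + ε * R / 2 := by positivity
  have h3 : Real.exp (-(ε * R / 2)) ≤ 1 / (1 + ε * R / 2) := by
    rw [Real.exp_neg, one_div]
    exact inv_anti₀ h2 h1
  have h4 : (1 / (1 + ε * R / 2)) * (R + 1) ≤ 1 + 2 / ε := by
    rw [div_mul_eq_mul_div, one_mul, div_le_iff₀ h2]
    have : (1 + 2 / ε) * (1 + ε * R / 2) = 1 + ε * R / 2 + 2 / ε + R := by field_simp; ring
    rw [this]
    have : 0 ≤ 2 / ε := by positivity
    nlinarith
  exact (mul_le_mul_of_nonneg_right h3 (by linarith)).trans h4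

/-- [folklore] **TWO CENTRES, CUBIC × LINEAR, DAMPED AT THE CUBIC CENTRE — THE POWER GAIN** (`d ≥ 2`, `ε > 0`; every finite `S`, all centres):
`Σ_{x∈S} e^{−ε‖x−u‖∞}∕(nrm(x−u)^{d−1}·nrm(x−v)) ≤ (1 + 2d·3^{d−1})·(2 + 3^{d−1})·(1 + 2∕ε)∕nrm(u−v)`.  Off the half-ball at `v` the linear factor is
`≤ 2∕(R+1)` and the damped one-centre sum at `u` is `O(1 + 1∕ε)`; on it the cubic factor is `≤ (3∕(R+1))^{d−1}`, the damping `≤ e^{−εR∕2} ≤ (1+2∕ε)∕(R+1)`,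
and the window sum of `1∕nrm(x−v)` is `≤ 1 + κ_d R^{d−1}`.  (The kit's critical `sum_exp_div_nrm_pow_mul_crit_le` gives `c·log n` at `ε = δ∕n`; this form
trades the logarithm for the census-summable `1∕nrm(u−v)` at the price `1∕ε ∝ n`.) -/
theorem sum_exp_div_nrm_pow_mul_nrm_le (hd : 2 ≤ d) {ε : ℝ} (hε : 0 < ε) (S : Finset (Site d)) (u v : Site d) :
    ∑ x ∈ S, Real.exp (-ε * supNorm (x - u)) / (nrm (x - u) ^ (d - 1) * nrm (x - v))
      ≤ (1 + 2 * d * 3 ^ (d - 1)) * (2 + 3 ^ (d - 1)) * (1 + 2 / ε) / nrm (u - v) := by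
  classical
  have hd0 : 0 < d := by omega
  set R := supNorm (u - v) with hRdef
  set κ : ℝ := 2 * d * 3 ^ (d - 1) with hκ
  have hκ0 : 0 ≤ κ := by positivity
  have hR0 : (0 : ℝ) < (R : ℝ) + 1 := by positivity
  have hRv : supNorm (v - u) = R := by rw [show v - u = -(u - v) by abel, supNorm_neg]
  have hnrmR : nrm (u - v) ≤ (R : ℝ) + 1 := by
    rw [nrm_eq_max]; exact max_le (by linarith [(Nat.cast_nonneg R : (0 : ℝ) ≤ R)]) (by rw [hRdef]; linarith)
  have hε2 : 0 ≤ 2 / ε := by positivity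
  set f : Site d → ℝ := fun x => Real.exp (-ε * supNorm (x - u)) / (nrm (x - u) ^ (d - 1) * nrm (x - v)) with hf
  have hf0 : ∀ x, 0 ≤ f x := fun x => by have := nrm_pos (x - u); have := nrm_pos (x - v); positivity
  rw [← Finset.sum_filter_add_sum_filter_not S (fun x => 2 * supNorm (x - v) ≤ R)]
  -- (ii) the half-ball at `v`
  have hnear : ∑ x ∈ S.filter (fun x => 2 * supNorm (x - v) ≤ R), f x ≤ 3 ^ (d - 1) * (1 + κ) * (1 + 2 / ε) / ((R : ℝ) + 1) := by
    set S₁ := S.filter (fun x => 2 * supNorm (x - v) ≤ R) with hS₁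
    have hmem : ∀ x ∈ S₁, 2 * supNorm (x - v) ≤ R := fun x hx => (Finset.mem_filter.mp hx).2
    -- pointwise: `f x ≤ e^{−εR∕2}·(3∕(R+1))^{d−1}·(1∕nrm(x−v))`
    have hpt : ∀ x ∈ S₁, f x ≤ Real.exp (-(ε * R / 2)) * (3 / ((R : ℝ) + 1)) ^ (d - 1) * (1 / nrm (x - v) ^ 1) := by
      intro x hx
      have hxv := hmem x hx
      have h1 : ((R : ℝ) + 1) / 3 ≤ nrm (x - u) := by
        have h := nrm_ge_of_near (x := x) (u := v) (v := u) (by rw [hRv]; exact hxv)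
        rwa [hRv] at h
      have h2 : (R : ℝ) / 2 ≤ (supNorm (x - u) : ℝ) := by
        have t : supNorm (u - v) ≤ supNorm (x - u) + supNorm (x - v) := by
          have := supNorm_add_le (u - x) (x - v)
          rwa [show u - x + (x - v) = u - v by abel, show u - x = -(x - u) by abel, supNorm_neg] at this
        have t' : (R : ℝ) ≤ (supNorm (x - u) : ℝ) + supNorm (x - v) := by rw [hRdef]; exact_mod_cast t
        have t'' : 2 * (supNorm (x - v) : ℝ) ≤ R := by exact_mod_cast hxv
        linarith
      have hexp : Real.exp (-ε * supNorm (x - u)) ≤ Real.exp (-(ε * R / 2)) := Real.exp_le_exp.2 (by nlinarith)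
      have h3 : (0 : ℝ) < ((R : ℝ) + 1) / 3 := by positivity
      have hpow : (((R : ℝ) + 1) / 3) ^ (d - 1) ≤ nrm (x - u) ^ (d - 1) := pow_le_pow_left₀ h3.le h1 _
      have hv := nrm_pos (x - v); have hu := nrm_pos (x - u)
      rw [hf]
      calc Real.exp (-ε * supNorm (x - u)) / (nrm (x - u) ^ (d - 1) * nrm (x - v))
          ≤ Real.exp (-(ε * R / 2)) / ((((R : ℝ) + 1) / 3) ^ (d - 1) * nrm (x - v)) := by
            gcongr
        _ = Real.exp (-(ε * R / 2)) * (3 / ((R : ℝ) + 1)) ^ (d - 1) * (1 / nrm (x - v) ^ 1) := by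
            rw [div_pow, div_pow, pow_one]; field_simp
    have hwin : ∀ x ∈ S₁, supNorm (x - v) ≤ R := fun x hx => by have := hmem x hx; omega
    have hsum := sum_inv_nrm_pow_le hd0 (p := 1) (by omega) S₁ v hwin
    have hratio : (1 + κ * (R : ℝ) ^ (d - 1)) / ((R : ℝ) + 1) ^ (d - 1) ≤ 1 + κ := by
      rw [div_le_iff₀ (by positivity)]
      have h1 : (1 : ℝ) ≤ ((R : ℝ) + 1) ^ (d - 1) := one_le_pow₀ (by linarith)
      have h2 : (R : ℝ) ^ (d - 1) ≤ ((R : ℝ) + 1) ^ (d - 1) := pow_le_pow_left₀ (Nat.cast_nonneg R) (by linarith) _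
      nlinarith
    have hexpR : Real.exp (-(ε * R / 2)) ≤ (1 + 2 / ε) / ((R : ℝ) + 1) := by
      rw [le_div_iff₀ hR0]; exact exp_neg_half_mul_succ_le hε (Nat.cast_nonneg R)
    calc ∑ x ∈ S₁, f x ≤ ∑ x ∈ S₁, Real.exp (-(ε * R / 2)) * (3 / ((R : ℝ) + 1)) ^ (d - 1) * (1 / nrm (x - v) ^ 1) :=
          Finset.sum_le_sum hpt
      _ = Real.exp (-(ε * R / 2)) * (3 / ((R : ℝ) + 1)) ^ (d - 1) * ∑ x ∈ S₁, 1 / nrm (x - v) ^ 1 := by rw [Finset.mul_sum]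
      _ ≤ Real.exp (-(ε * R / 2)) * (3 / ((R : ℝ) + 1)) ^ (d - 1) * (1 + κ * (R : ℝ) ^ (d - 1)) := by
          rw [hκ]; exact mul_le_mul_of_nonneg_left hsum (by positivity)
      _ = Real.exp (-(ε * R / 2)) * 3 ^ (d - 1) * ((1 + κ * (R : ℝ) ^ (d - 1)) / ((R : ℝ) + 1) ^ (d - 1)) := by
          rw [div_pow]; field_simp
      _ ≤ (1 + 2 / ε) / ((R : ℝ) + 1) * 3 ^ (d - 1) * (1 + κ) := by gcongr
      _ = _ := by ring
  -- (i) off the half-ball at `v`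
  have hfar : ∑ x ∈ S.filter (fun x => ¬2 * supNorm (x - v) ≤ R), f x ≤ 2 * (1 + κ * (1 + 2 / ε)) / ((R : ℝ) + 1) := by
    set S₂ := S.filter (fun x => ¬2 * supNorm (x - v) ≤ R) with hS₂
    have hmem : ∀ x ∈ S₂, R < 2 * supNorm (x - v) := fun x hx => not_le.mp (Finset.mem_filter.mp hx).2
    have hpt : ∀ x ∈ S₂, f x ≤ 2 / ((R : ℝ) + 1) * (Real.exp (-ε * supNorm (x - u)) / nrm (x - u) ^ (d - 1)) := by
      intro x hx
      have h1 : (R : ℝ) + 1 ≤ 2 * nrm (x - v) := by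
        have t : R + 1 ≤ 2 * supNorm (x - v) := hmem x hx
        have t' : (R : ℝ) + 1 ≤ 2 * (supNorm (x - v) : ℝ) := by exact_mod_cast t
        linarith [supNorm_le_nrm (x - v)]
      have hv := nrm_pos (x - v); have hu := nrm_pos (x - u)
      rw [hf]
      calc Real.exp (-ε * supNorm (x - u)) / (nrm (x - u) ^ (d - 1) * nrm (x - v))
          = (1 / nrm (x - v)) * (Real.exp (-ε * supNorm (x - u)) / nrm (x - u) ^ (d - 1)) := by field_simp
        _ ≤ 2 / ((R : ℝ) + 1) * (Real.exp (-ε * supNorm (x - u)) / nrm (x - u) ^ (d - 1)) := by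
            refine mul_le_mul_of_nonneg_right ?_ (by positivity)
            rw [div_le_div_iff₀ hv hR0]; linarith
    have hsum := sum_exp_div_nrm_pow_le hd0 hε (p := d - 1) le_rfl S₂ u
    have e0 : ((d - 1 - (d - 1)).factorial : ℝ) * (2 / ε) ^ (d - 1 - (d - 1)) * (1 + 2 / ε) = 1 + 2 / ε := by
      rw [Nat.sub_self, Nat.factorial_zero, pow_zero]; push_cast; ring
    rw [e0, ← hκ] at hsum
    calc ∑ x ∈ S₂, f x ≤ ∑ x ∈ S₂, 2 / ((R : ℝ) + 1) * (Real.exp (-ε * supNorm (x - u)) / nrm (x - u) ^ (d - 1)) := Finset.sum_le_sum hpt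
      _ = 2 / ((R : ℝ) + 1) * ∑ x ∈ S₂, Real.exp (-ε * supNorm (x - u)) / nrm (x - u) ^ (d - 1) := by rw [Finset.mul_sum]
      _ ≤ 2 / ((R : ℝ) + 1) * (1 + κ * (1 + 2 / ε)) := mul_le_mul_of_nonneg_left hsum (by positivity)
      _ = _ := by ring
  -- total
  have h3 : (1 : ℝ) ≤ 3 ^ (d - 1) := one_le_pow₀ (by norm_num)
  have hnum : 3 ^ (d - 1) * (1 + κ) * (1 + 2 / ε) + 2 * (1 + κ * (1 + 2 / ε)) ≤ (1 + κ) * (2 + 3 ^ (d - 1)) * (1 + 2 / ε) := by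
    nlinarith
  calc ∑ x ∈ S.filter (fun x => 2 * supNorm (x - v) ≤ R), f x + ∑ x ∈ S.filter (fun x => ¬2 * supNorm (x - v) ≤ R), f x
      ≤ 3 ^ (d - 1) * (1 + κ) * (1 + 2 / ε) / ((R : ℝ) + 1) + 2 * (1 + κ * (1 + 2 / ε)) / ((R : ℝ) + 1) := add_le_add hnear hfar
    _ = (3 ^ (d - 1) * (1 + κ) * (1 + 2 / ε) + 2 * (1 + κ * (1 + 2 / ε))) / ((R : ℝ) + 1) := by rw [add_div]
    _ ≤ (1 + κ) * (2 + 3 ^ (d - 1)) * (1 + 2 / ε) / ((R : ℝ) + 1) := div_le_div_of_nonneg_right hnum hR0.le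
    _ ≤ (1 + κ) * (2 + 3 ^ (d - 1)) * (1 + 2 / ε) / nrm (u - v) :=
        div_le_div_of_nonneg_left (by positivity) (nrm_pos _) hnrmR

/-! ## §2 Needle bookkeeping: needle-weighted profiles through `applyK` and `pairing` -/

/-- [folklore] **A LEG ACTING ON A NEEDLE-WEIGHTED BOND FUNCTION** (finite sums, then `tsum`): if `|A x y c e| ≤ a y` (row `x`, fibre `c` fixed),
`|φ y e| ≤ Σ_{s∈N} q s·g s y` with `q ≥ 0` on `N`, `a ≥ 0`, and `Σ_{y∈T} a y·g s y ≤ G s` for every finite `T` and every `s ∈ N`, then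
`|applyK A φ x c| ≤ card F·Σ_{s∈N} q s·G s`. -/
theorem abs_applyK_le_of_needle {ι : Type*} {A : MKer d F} {φ : Site d → F → ℝ} (N : Finset ι) {q : ι → ℝ} (hq : ∀ s ∈ N, 0 ≤ q s)
    {a : Site d → ℝ} (ha0 : ∀ y, 0 ≤ a y) {g : ι → Site d → ℝ} {G : ι → ℝ} (x : Site d) (c : F)
    (hA : ∀ y e, |A x y c e| ≤ a y) (hφ : ∀ y e, |φ y e| ≤ ∑ s ∈ N, q s * g s y)
    (hG : ∀ s ∈ N, ∀ T : Finset (Site d), ∑ y ∈ T, a y * g s y ≤ G s) :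
    |applyK A φ x c| ≤ Fintype.card F * ∑ s ∈ N, q s * G s := by
  rw [applyK_apply]
  have hS : ∀ T : Finset (Site d), ∑ y ∈ T, |∑ e, A x y c e * φ y e| ≤ Fintype.card F * ∑ s ∈ N, q s * G s := by
    intro T
    have hpt : ∀ y ∈ T, |∑ e, A x y c e * φ y e| ≤ Fintype.card F * (a y * ∑ s ∈ N, q s * g s y) := by
      intro y _
      calc |∑ e, A x y c e * φ y e| ≤ ∑ e, |A x y c e * φ y e| := Finset.abs_sum_le_sum_abs _ _
        _ ≤ ∑ _e : F, a y * ∑ s ∈ N, q s * g s y := Finset.sum_le_sum fun e _ => by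
            rw [abs_mul]; exact mul_le_mul (hA y e) (hφ y e) (abs_nonneg _) (ha0 y)
        _ = Fintype.card F * (a y * ∑ s ∈ N, q s * g s y) := by rw [Finset.sum_const, nsmul_eq_mul, Finset.card_univ]
    calc ∑ y ∈ T, |∑ e, A x y c e * φ y e| ≤ ∑ y ∈ T, Fintype.card F * (a y * ∑ s ∈ N, q s * g s y) := Finset.sum_le_sum hpt
      _ = Fintype.card F * ∑ s ∈ N, q s * ∑ y ∈ T, a y * g s y := by
          rw [← Finset.mul_sum]
          congr 1
          simp only [Finset.mul_sum]
          rw [Finset.sum_comm]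
          exact Finset.sum_congr rfl fun s _ => Finset.sum_congr rfl fun y _ => by ring
      _ ≤ Fintype.card F * ∑ s ∈ N, q s * G s := by
          refine mul_le_mul_of_nonneg_left (Finset.sum_le_sum fun s hs => mul_le_mul_of_nonneg_left (hG s hs T) (hq s hs)) (Nat.cast_nonneg _)
  exact (summable_and_abs_tsum_le_of_abs_sum_le hS).2

/-- [folklore] **PAIRING, NEEDLE-WEIGHTED LEFT FACTOR**: `|ψ x c| ≤ Σ_{s∈N} q s·g s x` (`q ≥ 0` on `N`), `|χ x c| ≤ h x`, and
`Σ_{x∈S} g s x·h x ≤ G s` for every finite `S`, `s ∈ N` ⟹ summable and `|pairing ψ χ| ≤ card F·Σ_{s∈N} q s·G s`. -/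
theorem abs_pairing_le_of_needle_left {ι : Type*} {ψ χ : Site d → F → ℝ} (N : Finset ι) {q : ι → ℝ} (hq : ∀ s ∈ N, 0 ≤ q s)
    {g : ι → Site d → ℝ} {h : Site d → ℝ} {G : ι → ℝ}
    (hψ : ∀ x c, |ψ x c| ≤ ∑ s ∈ N, q s * g s x) (hχ : ∀ x c, |χ x c| ≤ h x)
    (hG : ∀ s ∈ N, ∀ S : Finset (Site d), ∑ x ∈ S, g s x * h x ≤ G s) :
    Summable (fun x => ∑ c, ψ x c * χ x c) ∧ |pairing ψ χ| ≤ Fintype.card F * ∑ s ∈ N, q s * G s := by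
  have hS : ∀ S : Finset (Site d), ∑ x ∈ S, |∑ c, ψ x c * χ x c| ≤ Fintype.card F * ∑ s ∈ N, q s * G s := by
    intro S
    have hpt : ∀ x ∈ S, |∑ c, ψ x c * χ x c| ≤ Fintype.card F * ((∑ s ∈ N, q s * g s x) * h x) := by
      intro x _
      calc |∑ c, ψ x c * χ x c| ≤ ∑ c, |ψ x c * χ x c| := Finset.abs_sum_le_sum_abs _ _
        _ ≤ ∑ _c : F, (∑ s ∈ N, q s * g s x) * h x := Finset.sum_le_sum fun c _ => by
            rw [abs_mul]
            exact mul_le_mul (hψ x c) (hχ x c) (abs_nonneg _) ((abs_nonneg _).trans (hψ x c))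
        _ = Fintype.card F * ((∑ s ∈ N, q s * g s x) * h x) := by rw [Finset.sum_const, nsmul_eq_mul, Finset.card_univ]
    calc ∑ x ∈ S, |∑ c, ψ x c * χ x c| ≤ ∑ x ∈ S, Fintype.card F * ((∑ s ∈ N, q s * g s x) * h x) := Finset.sum_le_sum hpt
      _ = Fintype.card F * ∑ s ∈ N, q s * ∑ x ∈ S, g s x * h x := by
          rw [← Finset.mul_sum]
          congr 1
          simp only [Finset.sum_mul, Finset.mul_sum]
          rw [Finset.sum_comm]
          exact Finset.sum_congr rfl fun s _ => Finset.sum_congr rfl fun x _ => by ring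
      _ ≤ Fintype.card F * ∑ s ∈ N, q s * G s := by
          refine mul_le_mul_of_nonneg_left (Finset.sum_le_sum fun s hs => mul_le_mul_of_nonneg_left (hG s hs S) (hq s hs)) (Nat.cast_nonneg _)
  have h := summable_and_abs_tsum_le_of_abs_sum_le hS
  exact ⟨h.1, by rw [pairing_def]; exact h.2⟩

/-- [folklore] **PAIRING OF TWO NEEDLE-WEIGHTED BOND FUNCTIONS**: `|ψ x c| ≤ Σ_{s∈N} q s·g s x`, `|χ x c| ≤ Σ_{s′∈N′} q′ s′·g′ s′ x` (`q, q′ ≥ 0`,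
`g′ ≥ 0`), and `Σ_{x∈S} g s x·g′ s′ x ≤ G s s′` for every finite `S` ⟹ summable and `|pairing ψ χ| ≤ card F·Σ_{s∈N} Σ_{s′∈N′} q s·q′ s′·G s s′`. -/
theorem abs_pairing_le_of_needle_needle {ι ι' : Type*} {ψ χ : Site d → F → ℝ} (N : Finset ι) (N' : Finset ι') {q : ι → ℝ} {q' : ι' → ℝ}
    (hq : ∀ s ∈ N, 0 ≤ q s) (hq' : ∀ s' ∈ N', 0 ≤ q' s') {g : ι → Site d → ℝ} {g' : ι' → Site d → ℝ}
    (hg'0 : ∀ s' ∈ N', ∀ x, 0 ≤ g' s' x) {G : ι → ι' → ℝ}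
    (hψ : ∀ x c, |ψ x c| ≤ ∑ s ∈ N, q s * g s x) (hχ : ∀ x c, |χ x c| ≤ ∑ s' ∈ N', q' s' * g' s' x)
    (hG : ∀ s ∈ N, ∀ s' ∈ N', ∀ S : Finset (Site d), ∑ x ∈ S, g s x * g' s' x ≤ G s s') :
    Summable (fun x => ∑ c, ψ x c * χ x c) ∧ |pairing ψ χ| ≤ Fintype.card F * ∑ s ∈ N, ∑ s' ∈ N', q s * q' s' * G s s' := by
  have hh0 : ∀ x, 0 ≤ ∑ s' ∈ N', q' s' * g' s' x := fun x => Finset.sum_nonneg fun s' hs' => mul_nonneg (hq' s' hs') (hg'0 s' hs' x)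
  -- per needle site `s` of the left factor: `Σ_x g s x·(Σ_{s′} q′ g′) ≤ Σ_{s′} q′·G s s′`
  have hG1 : ∀ s ∈ N, ∀ S : Finset (Site d), ∑ x ∈ S, g s x * (∑ s' ∈ N', q' s' * g' s' x) ≤ ∑ s' ∈ N', q' s' * G s s' := by
    intro s hs S
    calc ∑ x ∈ S, g s x * (∑ s' ∈ N', q' s' * g' s' x) = ∑ s' ∈ N', q' s' * ∑ x ∈ S, g s x * g' s' x := by
          simp only [Finset.mul_sum]
          rw [Finset.sum_comm]
          exact Finset.sum_congr rfl fun s' _ => Finset.sum_congr rfl fun x _ => by ring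
      _ ≤ ∑ s' ∈ N', q' s' * G s s' := Finset.sum_le_sum fun s' hs' => mul_le_mul_of_nonneg_left (hG s hs s' hs' S) (hq' s' hs')
  have h := abs_pairing_le_of_needle_left N hq (G := fun s => ∑ s' ∈ N', q' s' * G s s') hψ hχ hG1
  refine ⟨h.1, h.2.trans (le_of_eq ?_)⟩
  congr 1
  refine Finset.sum_congr rfl fun s _ => ?_
  rw [Finset.mul_sum]
  exact Finset.sum_congr rfl fun s' _ => by ring

end Summit.QuantumFields.BalabanUV.Beta.D1BFx.NeedleHLSGain
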